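import Summits.Ventures.QEC.CircuitDistance.ETowerLeverJ
import HarnessLib

/-!
# LEVER J — SOUNDNESS of the slim `s = 0` node (R159 (2); cell `qec`, experiment CDX, seat qec-cdx-idea-1 g4 draft; part 2 of 2)

Continuation of `ETowerLeverJ` (the solver `elimB`/`certJ`/`solve0s`, `fiberJ`, `nodeJ`, and `solve0s_complete`): here
* `fiberJ_complete` — the statement of the landed `ETower.fiberK_complete` with `fiberJ` for `fiberK` (S1ᴶ);
* `goodFibJ_of_all`, **`nodeJ_sound`** — the statements of the landed `goodFibK_of_all` / `nodeK_sound` with `fiberJ` / `nodeJ`.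
(LANDING NOTE, typist qec-cdx-type-2 g0: idea-1 g4's `LeverJSound.lean` 9fd2b4d34d41a43e split MECHANICALLY at the 400-line gate limit; the
declarations below are byte-identical to the audited file; crit-1 g2 S-audit PASS 2026-08-29T02:29:24Z on the unsplit file.)
std axioms, no `native_decide`, no `sorry`. Nothing here changes a deployed code.
-/

namespace Summit.Ventures.QEC.CircuitDistance.ETower

open Summit.Ventures.QEC.Census Summit.Ventures.QEC.Census.Fold


/-! ## S1ᴶ — fibre completeness of `fiberJ` (the statement of the landed `fiberK_complete`, with `fiberJ`) -/

section Complete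

variable {G : Geo} {nb : ℕ}

/-- **FIBRE COMPLETENESS of `fiberJ`** (same statement as `fiberK_complete`): the `1 ≤ s` branch IS `fiberK`; in the `s = 0` branch the word has no
doubled window slot (`e = []`) and the slim solver lists its fibre selection by `solve0s_complete`. -/
theorem fiberJ_complete (hG : OKK G nb) {col : ℕ → ℕ} {M Mp : ℕ → ℕ}
    (hM : ∀ j, j < nsK G nb → M j = col (G.emb j) ^^^ col (G.partner (G.emb j)))
    (hMp : ∀ j, j < nsK G nb → Mp j = col (G.partner (G.emb j))) {W t : ℕ} (ht : t < 2 ^ nsK G nb)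
    {out : List (List ℕ)} (hout : fiberJ G (nsK G nb) M Mp W (bitsOf (nsK G nb) 0 t) = some out) {u : ℕ}
    (hu : u < 2 ^ nK G nb) (hker : kerK col (nK G nb) u) (hwt : popc (nK G nb) u ≤ W) (hfold : foldWK G nb u = t) :
    ∃ S ∈ out, maskOf S = u ∧ (∀ J ∈ S, J < nK G nb) ∧ S.length = popc (nK G nb) u := by
  by_cases hs : 1 ≤ (W - (bitsOf (nsK G nb) 0 t).length) / 2
  · have hout' : fiberK G (nsK G nb) M Mp W (bitsOf (nsK G nb) 0 t) = some out := by
      unfold fiberJ at hout; rwa [if_pos hs] at hout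
    exact fiberK_complete hG hM hMp ht hout' hu hker hwt hfold
  · unfold fiberJ at hout
    rw [if_neg hs] at hout
    -- names
    set fc : ℕ → ℕ := fun j => col (G.emb j) ^^^ col (G.partner (G.emb j)) with hfcdef
    set P := bitsOf (nsK G nb) 0 t with hPdef
    set a := aPartK G nb u with ha
    set b := bPartK G nb u with hb
    have hab : a ^^^ b = t := by rw [ha, hb, ← foldWK_eq_parts, hfold]
    have hbt : b = a ^^^ t := by rw [← hab, ← Nat.xor_assoc, Nat.xor_self, Nat.zero_xor]
    have hPlt : ∀ j ∈ P, j < nsK G nb := fun j hj => lt_of_mem_bitsOf hj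
    have hPmask : maskOf P = t := maskOf_bitsOf_zero _ _ ht
    have hPlen : P.length = popc (nsK G nb) t := length_bitsOf _ _ _
    have hPM : P.map M = P.map fc := List.map_congr_left fun j hj => hM j (hPlt j hj)
    set O := outsideOf (nsK G nb) P with hOdef
    set e := O.filter fun j => (a &&& b).testBit j with hedef
    set x := restrictTo P 0 a with hxdef
    have hPnodup : P.Nodup := hPdef ▸ nodup_bitsOf _ _ _
    have hOmem : ∀ j, j ∈ O ↔ j < nsK G nb ∧ j ∉ P := fun j => by
      rw [hOdef, outsideOf, mem_bitsOf_zero_iff, Nat.testBit_xor, Nat.testBit_two_pow_sub_one,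
        testBit_maskOf_nodup P hPnodup]
      by_cases hj : j < nsK G nb <;> by_cases hp : j ∈ P <;> simp [hj, hp]
    have hOlt : ∀ j ∈ O, j < nsK G nb := fun j hj => ((hOmem j).1 hj).1
    have helt : ∀ j ∈ e, j < nsK G nb := fun j hj => hOlt j (List.mem_of_mem_filter hj)
    have heM : xorIdx M e = xorIdx fc e := xorIdx_congr fun j hj => hM j (helt j hj)
    have hfr : frhs Mp P = lin (fun j => col (G.partner (G.emb j))) (nsK G nb) 0 t := by
      rw [frhs, xorIdx_congr (h := fun j => col (G.partner (G.emb j))) (fun j hj => hMp j (hPlt j hj)),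
        xorIdx_eq_lin _ _ _ hPlt, hPmask]
    -- mask of e = a ∧ b
    have hOnodup : O.Nodup := hOdef ▸ nodup_bitsOf _ _ _
    have hecard : e.length = popc (nsK G nb) (a &&& b) := by
      rw [popc_eq_card, hedef, ← List.toFinset_card_of_nodup (hOnodup.filter _), List.toFinset_filter]
      congr 1
      ext i
      simp only [Finset.mem_filter, Finset.mem_range, List.mem_toFinset, hOmem]
      constructor
      · rintro ⟨⟨hi, -⟩, hb'⟩; exact ⟨hi, hb'⟩
      · rintro ⟨hi, hb'⟩
        refine ⟨⟨hi, ?_⟩, hb'⟩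
        rw [hPdef, mem_bitsOf_zero_iff, ← hab, Nat.testBit_xor]
        rw [Nat.testBit_and, Bool.and_eq_true] at hb'
        rw [hb'.1, hb'.2]; simp
    have hemask : maskOf e = a &&& b := by
      rw [hedef, maskOf_filter_testBit]
      apply Nat.eq_of_testBit_eq; intro i
      rw [Nat.testBit_and, testBit_maskOf_nodup O hOnodup]
      rcases hbit : (a &&& b).testBit i with _ | _
      · simp
      · simp only [Bool.true_and, decide_eq_true_eq, hOmem]
        rw [Nat.testBit_and, Bool.and_eq_true] at hbit
        refine ⟨?_, ?_⟩
        · by_contra hi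
          rw [not_lt] at hi
          have := Nat.testBit_lt_two_pow (lt_of_lt_of_le (aPartK_lt hG u) (Nat.pow_le_pow_right (by norm_num) hi))
          rw [← ha] at this; rw [this] at hbit; exact Bool.false_ne_true hbit.1
        · have hti : t.testBit i = false := by
            rw [← hab, Nat.testBit_xor, hbit.1, hbit.2]; rfl
          rw [hPdef, mem_bitsOf_zero_iff, hti]; simp
    -- budget
    have hw : popc (nK G nb) u = popc (nsK G nb) t + 2 * popc (nsK G nb) (a &&& b) := by
      rw [popc_eq_partsK hG hu, ← ha, ← hb, ← popc_xor_add, hab]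
    have hlen : e.length ≤ (W - P.length) / 2 := by rw [hecard, hPlen]; omega
    -- the linear system
    have hsys : selXor (P.map M) x = frhs Mp P ^^^ xorIdx M e := by
      have h0 : lin col (nK G nb) 0 u = 0 := hker
      rw [reconK hG hu, lin_xor, lin_col_embWK hG, lin_col_parWK hG, ← ha, ← hb, hbt, lin_xor] at h0
      have hf : lin (fun j => col (G.emb j)) (nsK G nb) 0 a ^^^ lin (fun j => col (G.partner (G.emb j))) (nsK G nb) 0 a =
          lin fc (nsK G nb) 0 a := by rw [← lin_xor_fun]
      have ha2 : lin fc (nsK G nb) 0 a = xorIdx M e ^^^ selXor (P.map M) x := by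
        conv_lhs => rw [← and_xor_self_decomp a b, hab, lin_xor]
        rw [heM, hPM, xorIdx_eq_lin _ _ _ helt, hemask, selXor_map_eq_lin _ _ _ hPlt, hxdef, selP_restrictTo, hPmask]
      rw [← Nat.xor_assoc, hf, ← hfr, ha2] at h0
      exact xor_eq_of_xor_xor_eq_zero h0
    -- s = 0: no doubled slot
    have he0 : e = [] := List.eq_nil_of_length_eq_zero (by omega)
    have hsys0 : selXor (P.map M) x = frhs Mp P := by rw [hsys, he0]; simp [xorIdx]
    have hxlt : x < 2 ^ (P.map M).length := by
      rw [List.length_map, hxdef]; have := restrictTo_lt P 0 a; rwa [Nat.zero_add] at this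
    split at hout
    · simp at hout
    · rename_i xs hxs
      simp only [Option.some.injEq] at hout
      subst hout
      have hxmem : x ∈ xs := by
        have := solve0s_complete hxs hsys0
        rwa [Nat.mod_eq_of_lt hxlt] at this
      have herev : ∀ j ∈ e.reverse, j < nsK G nb := fun j hj => helt j (List.mem_reverse.1 hj)
      refine ⟨mkWord G P e.reverse x, ?_, ?_, mkWord_boundK hG P e.reverse hPlt herev x, ?_⟩
      · rw [he0, List.reverse_nil]; exact List.mem_map.2 ⟨x, hxmem, rfl⟩
      · have h1 : (a &&& b) ^^^ (a &&& t) = a := by rw [← hab]; exact and_xor_self_decomp a b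
        have h2 : (a &&& b) ^^^ (t ^^^ (a &&& t)) = b := by
          rw [Nat.xor_left_comm, h1, hbt, Nat.xor_comm]
        rw [maskOf_mkWordK P e.reverse hPlt herev, maskOf_reverse, hemask, hxdef, selP_restrictTo, hPmask, h1, h2]
        exact (reconK hG hu).symm
      · rw [Geo.length_mkWord, List.length_reverse, hw, hecard, hPlen]; ring


end Complete

/-! ## Node soundness (the statements of the landed `goodFibK_of_all` / `nodeK_sound`, with `fiberJ` / `nodeJ`) -/

section Level

variable {G : Geo} {nb : ℕ}

/-- `goodFibK_of_all` for `fiberJ`. -/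
theorem goodFibJ_of_all (hG : OKK G nb) {col : ℕ → ℕ} {M Mp : ℕ → ℕ}
    (hM : ∀ j, j < nsK G nb → M j = col (G.emb j) ^^^ col (G.partner (G.emb j)))
    (hMp : ∀ j, j < nsK G nb → Mp j = col (G.partner (G.emb j))) {W : ℕ} {t : ℕ} (ht : t < 2 ^ nsK G nb)
    {out : List (List ℕ)} (hout : fiberJ G (nsK G nb) M Mp W (bitsOf (nsK G nb) 0 t) = some out)
    {kk : List ℕ → Bool} {K : ℕ → Prop}
    (hkk : ∀ S', (∀ J ∈ S', J < nK G nb) → S'.length = popc (nK G nb) (maskOf S') → kk S' = true → K (maskOf S'))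
    (hall : out.all kk = true) : GoodFibK G nb col W K t := by
  intro u hu hker hwt hfold
  obtain ⟨S', hS', hmask, hbnd, hlen⟩ := fiberJ_complete hG hM hMp ht hout hu hker hwt hfold
  rw [List.all_eq_true] at hall
  have := hkk S' hbnd (by rw [hmask]; exact hlen) (hall S' hS')
  rwa [hmask] at this

/-- **NODE SOUNDNESS of `nodeJ`** (the statement of the landed `nodeK_sound`, with `nodeJ`): a passing node of the small word with support `S` gives
`GoodFibK … Q (maskOf S)` — enumeration by `fiberJ_complete`, pair guard by `goodFibK_of_guarded`. -/
theorem nodeJ_sound (hS : G.Shape) (hG : OKK G nb) {col : ℕ → ℕ}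
    (hK : ∀ u, u < 2 ^ nK G nb → (kerK col (nK G nb) u ↔ kerK col (nK G nb) (transWK G.l G.m nb G.gen.1 G.gen.2 u)))
    {M Mp : ℕ → ℕ} (hM : ∀ j, j < nsK G nb → M j = col (G.emb j) ^^^ col (G.partner (G.emb j)))
    (hMp : ∀ j, j < nsK G nb → Mp j = col (G.partner (G.emb j)))
    {W : ℕ} {k : List ℕ → Bool} {Q : ℕ → Prop} (hQ : ∀ u, Q (transWK G.l G.m nb G.gen.1 G.gen.2 u) → Q u)
    (hk : ∀ S', (∀ J ∈ S', J < nK G nb) → S'.length = popc (nK G nb) (maskOf S') → k S' = true → Q (maskOf S'))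
    {S : List ℕ} (hSb : ∀ j ∈ S, j < nsK G nb) (h : nodeJ G (nsK G nb) M Mp W k S = true) :
    GoodFibK G nb col W Q (maskOf S) := by
  have hSlt : maskOf S < 2 ^ nsK G nb := maskOf_lt _ _ hSb
  unfold nodeJ at h
  simp only at h
  split at h
  · simp at h
  · rename_i out hout
    have hout' : fiberJ G (nsK G nb) M Mp W (bitsOf (nsK G nb) 0 (maskOf S)) = some out := hout
    cases hP : bitsOf (nsK G nb) 0 (maskOf S) with
    | nil =>
      rw [hP] at h
      exact goodFibJ_of_all hG hM hMp hSlt hout' (kk := guardP G [] k) (K := Q)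
        (fun S' hS' hl h' => hk S' hS' hl (by simpa [guardP] using h')) h
    | cons p₀ P' =>
      rw [hP] at h
      have hKK := goodFibJ_of_all hG hM hMp hSlt hout' (kk := guardP G (p₀ :: P') k)
        (K := fun u => u.testBit (G.emb p₀) = false ∨ Q u) (guardP_cons_soundK (p₀ := p₀) (P' := P') hk) h
      have hp₀ : p₀ ∈ bitsOf (nsK G nb) 0 (maskOf S) := by rw [hP]; exact List.mem_cons_self ..
      rw [mem_bitsOf_zero_iff] at hp₀
      exact goodFibK_of_guarded hG hS hK hSlt hp₀.1 hp₀.2 hQ hKK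

end Level

end Summit.Ventures.QEC.CircuitDistance.ETower
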